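import Literature.MathematicalPhysics.QuantumLattice.AnisotropicHeisenbergLargeSpinNeelOrder
import Literature.MathematicalPhysics.QuantumLattice.AnisotropicHeisenbergThermalKLSCertificate
import HarnessLib

/-!
# Néel order of the layered spin-`S` Heisenberg antiferromagnet for every `S ≥ 3/2` (all interlayer
# ratios `0 < r ≤ 1`) and for `S = 1` (`0 < r ≤ 2/3`), unconditionally — the in-plane kernel

Topic `MathematicalPhysics/QuantumLattice`; closes the certificate hypothesis of
`heisAniso_neelLRO_of_integral_dirCertificate` (`AnisotropicHeisenbergNeelOrder.lean`) and of its
thermal twin `heisAniso_thermal_neelLRO_of_integral_dirCertificate`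
(`AnisotropicHeisenbergThermalKLSCertificate.lean`) for Kennedy–Lieb–Shastry's layered model
[KLS1988JSP] eq. (5), `H = Σ_x (𝐒_x·𝐒_{x+e₁} + 𝐒_x·𝐒_{x+e₂} + r 𝐒_x·𝐒_{x+e₃})`, `K = (1, 1, r)`,
`0 < r ≤ 1`, WITHOUT any new numerical input, by the choice of **in-plane multipliers**
`(t, μ) = (0, (-½, -½, 0))` in the two-sum-rule bound (one multiplier for the in-plane sum rules
(3₁) + (3₂), none for (3₃) and (2)): the kernel `{½(cos p₁ + cos p₂)}₊` is then exactly the kernel of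
the two-dimensional Kennedy–Lieb–Shastry integrand, and

* `heisAnisoKlsIntegrand_planar_le` — a.e. on the Brillouin zone (all `cos pᵢ < 1`),
  `G^{(1,1,r)}_{0,(-½,-½,0)}(p) ≤ F₂(p₁,p₂) + (r/2√2)·F_{(1,1)}(p₁,p₂)`, where
  `F₂(p₁,p₂) = x₊√((1+x)/(1-x))`, `x = ½(cos p₁ + cos p₂)` is the tree's `klsIntegrand 2` and
  `F_{(1,1)} = √2 x₊/√(1-x)` the tree's `anisoKlsIntegrand (1,1)`: bound the interlayer terms by
  `r(1 + cos p₃) ≤ 2r` upstairs and `r(1 - cos p₃) ≥ 0` downstairs, then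
  `√(1 + x + r) ≤ √(1 + x) + r/2`;
* `heisAnisoKlsIntegral_planar_le` — integrating out `p₃` (`setLIntegral_box_comp_succAbove`) and
  inserting the tree's CERTIFIED two-dimensional values `∫_{[-π,π]²}F₂ ≤ 15√2π²/16 + 4π`
  (`lintegral_klsIntegrand_two_le_sharp`, i.e. `I(2) ≤ 15√2/64 + 1/π = 0.64977`,
  [KLS1988PRL] "`I(2) = 0.65`") and `∫_{[-π,π]²}F_{(1,1)} ≤ √2π² + 4√2(3823/5040)π`
  (`lintegral_anisoKlsIntegrand_two_le`):
  **`𝓘^{(1,1,r)}_{0,(-½,-½,0)} ≤ W̄(r) := 15√2/64 + 1/π + r(1/8 + 3823/(10080π))`**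
  (`= 0.64977 + 0.24573 r`);
* `planar_certificate` — the real-arithmetic certificate of the direction-resolved form: on the
  window `s = -ε₁ = -ε₂ ∈ [S²/3, S²]` forced by (N) and (X),
  `s - (s/2)^{1/2} W ≥ S²/3 - SW/√6` whenever `W√6 ≤ 4S` (AM–GM at `s = S²/3`);
* **`layeredHeis_planar_neelOrderParameter_ge`** — for `0 < r ≤ 1` and every spin `S = n/2 ≥ 1`,
  along the even tori `(ℤ/2kℤ)³`:
  `liminf |Λ|⁻² Σ_{x,y}(-1)^{x+y}⟨𝐒_x·𝐒_y⟩_{GS} ≥ S² - (3/√6)·S·W̄(r)`;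
* **`layeredHeis_neelLRO_threeHalves`** — `S ≥ 3/2`, every `0 < r ≤ 1`: the floor is `≥ S(S - 1.1)`,
  Néel long-range order in the ground state (improves the tree's `S ≥ 11/2`,
  `layeredHeis_neelLRO_largeSpin`);
* **`layeredHeis_neelLRO_spinOne`** — `S ≥ 1`, every `0 < r ≤ 2/3`: Néel long-range order in the
  ground state (`(3/√6)W̄(2/3) < 1`); `layeredHeis_neelOrderParameter_ge_spinOne_half`: for
  `0 < r ≤ 1/2` the floor is `≥ 1/20`;
* thermal twins (`layeredHeis_planar_thermalNeelOrderParameter_ge`,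
  `layeredHeis_neelLRO_thermal_threeHalves`, `layeredHeis_neelLRO_thermal_spinOne`): at inverse
  temperature `β`, the floor loses `log(n+1)/((2+r)β) + 3C(r)/(2β)`, `C(r) = klsConstant r ≤ 3 + log(1/r)`
  — Néel order of the layered antiferromagnet for `S ≥ 3/2` (all `0 < r ≤ 1`) and `S = 1`
  (`0 < r ≤ 1/2`) at all temperatures below an explicit `const/(3 + log(J∥/J⊥))`.

What is printed and what is assembled: [KLS1988JSP] §3 proves Néel order for the model (5) with
`S = ½`, `1 ≥ r ≥ 0.16` by a numerical evaluation of (6)–(9), and p. 1020 remarks that `d = 2`,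
`S ≥ 1` has ground-state Néel order ("`I(2) = 0.65`" of [KLS1988PRL]; in the tree
`kennedy_lieb_shastry_ground`, `d = 2`, `2 ≤ n`); [DLS1978] Thm. 6.2 is the large-spin /
low-temperature statement for `ν ≥ 3`. The present file is the layered (`0 < r ≤ 1`) counterpart
for `S ≥ 1`, obtained from the SAME printed two-dimensional integral by the in-plane choice of
multipliers; no statement of the sources is altered, no named fact is introduced, nothing numerical
beyond the tree's certified `I(2)`-bounds, rational arithmetic and the decimal brackets
`1.41421 < √2 < 1.41422`, `2.44948 < √6`, `3.14159 < π`.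

## References

* [KLS1988JSP] T. Kennedy, E. H. Lieb, B. S. Shastry, *Existence of Néel order in some spin-½
  Heisenberg antiferromagnets*, J. Stat. Phys. 53 (1988) 1019–1030, §3, eqs. (5)–(9), p. 1020.
* [KLS1988PRL] T. Kennedy, E. H. Lieb, B. S. Shastry, Phys. Rev. Lett. 61 (1988) 2582–2584,
  eq. (8) and the value `I(2) = 0.65`.
* [DLS1978] F. J. Dyson, E. H. Lieb, B. Simon, J. Stat. Phys. 18 (1978) 335–383, Thm. 6.2.
-/

noncomputable section

open MeasureTheory Set Filter Topology Finset
open scoped ENNReal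
open Literature.MathematicalPhysics.QuantumLattice Literature.Probability.LatticeModels
  Literature.MathematicalPhysics.QuantumFieldTheory.Balaban1983to89.Beta

namespace Literature.MathematicalPhysics.QuantumLattice

/-! ### The in-plane multipliers and the pointwise majorant -/

section Pointwise

/-- The in-plane multipliers `μ = (-½, -½, 0)` of the two in-plane sum rules (3₁), (3₂).
[cite: KLS1988JSP, eqs. (3), (6)] -/
theorem planarMultiplier_sum : ∑ i, (![-(1 / 2 : ℝ), -(1 / 2), 0] : Fin 3 → ℝ) i = -1 := by
  rw [Fin.sum_univ_three]
  show -(1 / 2 : ℝ) + -(1 / 2) + 0 = -1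
  norm_num

/-- **The integrand at the in-plane multipliers**: with `x = ½(cos p₁ + cos p₂)`,
`G^{(1,1,r)}_{0,(-½,-½,0)}(p) = x₊ · [(2 + 2x + r(1 + cos p₃)) / (2 - 2x + r(1 - cos p₃))]^{1/2}`.
[cite: KLS1988JSP, eqs. (6)-(9)] -/
theorem heisAnisoKlsIntegrand_planar_eq (r : ℝ) (p : Fin 3 → ℝ) :
    heisAnisoKlsIntegrand ![(1 : ℝ), 1, r] 0 ![-(1 / 2 : ℝ), -(1 / 2), 0] p =
      max ((Real.cos (p 0) + Real.cos (p 1)) / 2) 0 *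
        Real.sqrt ((2 + (Real.cos (p 0) + Real.cos (p 1)) + r * (1 + Real.cos (p 2))) /
          (2 - (Real.cos (p 0) + Real.cos (p 1)) + r * (1 - Real.cos (p 2)))) := by
  rw [heisAnisoKlsIntegrand, NVectorAniso.anisoDispersion, Fin.sum_univ_three, Fin.sum_univ_three,
    Fin.sum_univ_three]
  simp only [Matrix.cons_val_zero, Matrix.cons_val_one, Matrix.cons_val]
  congr 1
  · congr 1
    ring
  · congr 1
    · congr 1 <;> ring

/-- The deleted-coordinate map at `k = 2` lists the two in-plane momenta. [folklore] -/
private theorem succAbove_two_eq (p : Fin 3 → ℝ) :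
    (fun j : Fin 2 => p ((2 : Fin 3).succAbove j)) = ![p 0, p 1] := by
  funext j
  fin_cases j <;> rfl

/-- The tree's two-direction XY integrand at equal couplings, in the variable
`u = cos a + cos b`: `F_{(1,1)}(a,b) = u₊ (2 - u)^{-1/2}`. [cite: KLS1988PRL, eq. (8)] -/
theorem anisoKlsIntegrand_pair_eq (a b : ℝ) :
    anisoKlsIntegrand ![(1 : ℝ), 1] ![a, b] =
      max (Real.cos a + Real.cos b) 0 * Real.sqrt (1 / (2 - (Real.cos a + Real.cos b))) := by
  rw [anisoKlsIntegrand, anisoCosSum, NVectorAniso.anisoDispersion, Fin.sum_univ_two,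
    Fin.sum_univ_two, Fin.sum_univ_two]
  simp only [Matrix.cons_val_zero, Matrix.cons_val_one, one_mul]
  congr 1
  rcases eq_or_ne (2 - (Real.cos a + Real.cos b)) 0 with h | h
  · have h' : (1 - Real.cos a + (1 - Real.cos b)) = 0 := by linarith
    rw [h', h, mul_zero, div_zero, div_zero]
  · congr 1
    have h' : (1 - Real.cos a + (1 - Real.cos b)) ≠ 0 := by
      intro h''; exact h (by linarith)
    field_simp
    ring

/-- `√(1 + x + r) ≤ √(1 + x) + r/2` for `x, r ≥ 0` (`√(1+x) ≥ 1`). [folklore] -/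
private theorem sqrt_one_add_add_le {x r : ℝ} (hx : 0 ≤ x) (hr : 0 ≤ r) :
    Real.sqrt (1 + x + r) ≤ Real.sqrt (1 + x) + r / 2 := by
  have h1 : 1 ≤ Real.sqrt (1 + x) := by
    calc (1 : ℝ) = Real.sqrt 1 := Real.sqrt_one.symm
      _ ≤ Real.sqrt (1 + x) := Real.sqrt_le_sqrt (by linarith)
  have hs : Real.sqrt (1 + x) ^ 2 = 1 + x := Real.sq_sqrt (by linarith)
  have hle : 1 + x + r ≤ (Real.sqrt (1 + x) + r / 2) ^ 2 := by
    nlinarith [mul_nonneg hr (sub_nonneg.2 h1)]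
  calc Real.sqrt (1 + x + r) ≤ Real.sqrt ((Real.sqrt (1 + x) + r / 2) ^ 2) := Real.sqrt_le_sqrt hle
    _ = Real.sqrt (1 + x) + r / 2 := Real.sqrt_sq (by positivity)

/-- **The pointwise majorant.** For `r ≥ 0`, at every `p` with `cos p₁ < 1`:
`G^{(1,1,r)}_{0,(-½,-½,0)}(p) ≤ F₂(p₁,p₂) + (r/2√2) F_{(1,1)}(p₁,p₂)`: on `{x ≤ 0}` both sides
vanish resp. are `≥ 0`; on `{0 < x < 1}` the interlayer terms are bounded by
`r(1 + cos p₃) ≤ 2r`, `r(1 - cos p₃) ≥ 0`, so `G ≤ x√((1+x+r)/(1-x))`, and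
`√(1+x+r) ≤ √(1+x) + r/2`. [cite: KLS1988JSP, eqs. (6)-(9)] [cite: KLS1988PRL, eq. (8)] -/
theorem heisAnisoKlsIntegrand_planar_le {r : ℝ} (hr : 0 ≤ r) {p : Fin 3 → ℝ}
    (hp : Real.cos (p 0) < 1) :
    heisAnisoKlsIntegrand ![(1 : ℝ), 1, r] 0 ![-(1 / 2 : ℝ), -(1 / 2), 0] p ≤
      klsIntegrand 2 (fun j : Fin 2 => p ((2 : Fin 3).succAbove j)) +
        r / (2 * Real.sqrt 2) * anisoKlsIntegrand ![(1 : ℝ), 1] (fun j : Fin 2 => p ((2 : Fin 3).succAbove j)) := by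
  rw [succAbove_two_eq, klsIntegrand_two, anisoKlsIntegrand_pair_eq, heisAnisoKlsIntegrand_planar_eq]
  set c₀ := Real.cos (p 0) with hc₀
  set c₁ := Real.cos (p 1) with hc₁
  set c₂ := Real.cos (p 2) with hc₂
  set x : ℝ := (c₀ + c₁) / 2 with hx
  have hc₁1 : c₁ ≤ 1 := Real.cos_le_one _
  have hc₂1 : c₂ ≤ 1 := Real.cos_le_one _
  have hc₂1' : -1 ≤ c₂ := Real.neg_one_le_cos _
  have hx1 : x < 1 := by rw [hx]; linarith
  have hs2 : 0 < Real.sqrt 2 := Real.sqrt_pos.2 (by norm_num)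
  have hF0 : 0 ≤ Real.sqrt ((1 + x) / (1 - x)) * max x 0 := by positivity
  have hA0 : 0 ≤ r / (2 * Real.sqrt 2) * (max (c₀ + c₁) 0 * Real.sqrt (1 / (2 - (c₀ + c₁)))) := by
    positivity
  have hu : c₀ + c₁ = 2 * x := by rw [hx]; ring
  rcases le_or_gt x 0 with hx0 | hx0
  · -- both kernels vanish on the left
    rw [max_eq_right hx0, zero_mul]
    positivity
  · -- `0 < x < 1`
    have hxm : max x 0 = x := max_eq_left hx0.le
    have hum : max (c₀ + c₁) 0 = 2 * x := by rw [hu]; exact max_eq_left (by linarith)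
    rw [hxm, hum, hu]
    have h1x : 0 < 1 - x := by linarith
    -- the interlayer terms
    have hN : 2 + 2 * x + r * (1 + c₂) ≤ 2 * (1 + x + r) := by nlinarith
    have hD : 2 * (1 - x) ≤ 2 - 2 * x + r * (1 - c₂) := by nlinarith
    have hsq : Real.sqrt ((2 + 2 * x + r * (1 + c₂)) / (2 - 2 * x + r * (1 - c₂))) ≤
        Real.sqrt ((2 * (1 + x + r)) / (2 * (1 - x))) :=
      Real.sqrt_le_sqrt (div_le_div₀ (by positivity) hN (by positivity) hD)
    have hsimp : (2 * (1 + x + r)) / (2 * (1 - x)) = (1 + x + r) / (1 - x) :=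
      mul_div_mul_left _ _ two_ne_zero
    rw [hsimp] at hsq
    -- the square roots as quotients
    have hsx : 0 < Real.sqrt (1 - x) := Real.sqrt_pos.2 h1x
    have e1 : Real.sqrt ((1 + x + r) / (1 - x)) = Real.sqrt (1 + x + r) / Real.sqrt (1 - x) :=
      Real.sqrt_div (by linarith) _
    have e2 : Real.sqrt ((1 + x) / (1 - x)) = Real.sqrt (1 + x) / Real.sqrt (1 - x) :=
      Real.sqrt_div (by linarith) _
    have e3 : Real.sqrt (1 / (2 - 2 * x)) = 1 / (Real.sqrt 2 * Real.sqrt (1 - x)) := by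
      rw [show (2 : ℝ) - 2 * x = 2 * (1 - x) by ring, Real.sqrt_div' 1 (mul_nonneg zero_le_two h1x.le),
        Real.sqrt_one, Real.sqrt_mul (by norm_num : (0 : ℝ) ≤ 2)]
    have hs2sq : Real.sqrt 2 ^ 2 = 2 := Real.sq_sqrt (by norm_num)
    have hkey := sqrt_one_add_add_le hx0.le hr
    calc x * Real.sqrt ((2 + 2 * x + r * (1 + c₂)) / (2 - 2 * x + r * (1 - c₂)))
        ≤ x * Real.sqrt ((1 + x + r) / (1 - x)) := mul_le_mul_of_nonneg_left hsq hx0.le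
      _ = x * Real.sqrt (1 + x + r) / Real.sqrt (1 - x) := by rw [e1, mul_div_assoc]
      _ ≤ x * (Real.sqrt (1 + x) + r / 2) / Real.sqrt (1 - x) :=
          div_le_div_of_nonneg_right (mul_le_mul_of_nonneg_left hkey hx0.le) hsx.le
      _ = Real.sqrt ((1 + x) / (1 - x)) * x +
            r / (2 * Real.sqrt 2) * (2 * x * Real.sqrt (1 / (2 - 2 * x))) := by
          rw [e2, e3]
          field_simp
          linear_combination r * hs2sq

end Pointwise

/-! ### The integral bound from the tree's certified two-dimensional values -/

section Integral

/-- Local copy of the measurability of the anisotropic XY integrand (private upstream).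
[cite: KLS1988PRL, eq. (8)] -/
private theorem measurable_anisoKlsIntegrand' {d : ℕ} (K : Fin d → ℝ) :
    Measurable (anisoKlsIntegrand K) := by
  unfold anisoKlsIntegrand anisoCosSum NVectorAniso.anisoDispersion
  refine Measurable.mul ?_ (Real.continuous_sqrt.measurable.comp ?_)
  · exact (Finset.measurable_sum _ fun i _ =>
      (Real.measurable_cos.comp (measurable_pi_apply i)).const_mul _).max measurable_const
  · exact measurable_const.div (measurable_const.mul (Finset.measurable_sum _ fun i _ =>
      (measurable_const.sub (Real.measurable_cos.comp (measurable_pi_apply i))).const_mul _))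

/-- The explicit constant `W̄(r) = 15√2/64 + 1/π + r(1/8 + 3823/(10080π))` (`0.64977 + 0.24573r`)
bounding the two-sum-rule integral at the in-plane multipliers. [cite: KLS1988PRL, after eq. (8)] -/
theorem planarBound_nonneg {r : ℝ} (hr : 0 ≤ r) :
    0 ≤ 15 * Real.sqrt 2 / 64 + 1 / Real.pi + r * (1 / 8 + 3823 / (10080 * Real.pi)) := by
  positivity

/-- **`𝓘^{(1,1,r)}_{0,(-½,-½,0)} ≤ W̄(r) = 15√2/64 + 1/π + r(1/8 + 3823/(10080π))`** (`0 < r`):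
the pointwise majorant a.e. (all `cos pᵢ < 1`, `ae_forall_cos_apply_lt_one`), integration of the
deleted coordinate `p₃` (`setLIntegral_box_comp_succAbove`, a factor `2π`), and the tree's certified
`∫_{[-π,π]²}F₂ ≤ 15√2π²/16 + 4π` (`lintegral_klsIntegrand_two_le_sharp`) and
`∫_{[-π,π]²}F_{(1,1)} ≤ √2π² + 4√2(3823/5040)π` (`lintegral_anisoKlsIntegrand_two_le`).
[cite: KLS1988JSP, eqs. (6)-(9)] [cite: KLS1988PRL, after eq. (8)] -/
theorem heisAnisoKlsIntegral_planar_le {r : ℝ} (hr : 0 < r) :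
    heisAnisoKlsIntegral ![(1 : ℝ), 1, r] 0 ![-(1 / 2 : ℝ), -(1 / 2), 0] ≤
      15 * Real.sqrt 2 / 64 + 1 / Real.pi + r * (1 / 8 + 3823 / (10080 * Real.pi)) := by
  set K : Fin 3 → ℝ := ![(1 : ℝ), 1, r] with hKdef
  set μ : Fin 3 → ℝ := ![-(1 / 2 : ℝ), -(1 / 2), 0] with hμdef
  have hK : ∀ i, 0 < K i := by
    intro i; fin_cases i
    · show (0 : ℝ) < 1; norm_num
    · show (0 : ℝ) < 1; norm_num
    · show (0 : ℝ) < r; exact hr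
  have hπ : 0 < Real.pi := Real.pi_pos
  have hs2 : 0 < Real.sqrt 2 := Real.sqrt_pos.2 (by norm_num)
  have h2π3 : (0 : ℝ) < (2 * Real.pi) ^ 3 := by positivity
  -- the integrand is nonnegative and integrable on the Brillouin zone
  have hGi := integrableOn_heisAnisoKlsIntegrand (le_refl 3) hK 0 μ
  have hbox : brillouin 3 = Set.pi univ (fun _ : Fin 3 => Icc (-Real.pi) Real.pi) := rfl
  -- (1) Bochner integral = Lebesgue integral
  have hint : ∫ p in brillouin 3, heisAnisoKlsIntegrand K 0 μ p =
      (∫⁻ p in brillouin 3, ENNReal.ofReal (heisAnisoKlsIntegrand K 0 μ p)).toReal :=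
    integral_eq_lintegral_of_nonneg_ae
      (Eventually.of_forall fun p => heisAnisoKlsIntegrand_nonneg K 0 μ p) hGi.aestronglyMeasurable
  -- (2) the a.e. majorant
  set F : (Fin 3 → ℝ) → ℝ≥0∞ := fun p =>
    ENNReal.ofReal (klsIntegrand 2 (fun j : Fin 2 => p ((2 : Fin 3).succAbove j))) with hFdef
  set A : (Fin 3 → ℝ) → ℝ≥0∞ := fun p =>
    ENNReal.ofReal (anisoKlsIntegrand ![(1 : ℝ), 1] (fun j : Fin 2 => p ((2 : Fin 3).succAbove j)))
    with hAdef
  have hFm : Measurable F :=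
    ENNReal.measurable_ofReal.comp ((measurable_klsIntegrand 2).comp
      (measurable_pi_lambda _ fun j => measurable_pi_apply _))
  have hAm : Measurable A :=
    ENNReal.measurable_ofReal.comp ((measurable_anisoKlsIntegrand' _).comp
      (measurable_pi_lambda _ fun j => measurable_pi_apply _))
  have hae : ∀ᵐ p ∂(volume.restrict (brillouin 3)),
      ENNReal.ofReal (heisAnisoKlsIntegrand K 0 μ p) ≤
        F p + ENNReal.ofReal (r / (2 * Real.sqrt 2)) * A p := by
    filter_upwards [ae_restrict_of_ae (ae_forall_cos_apply_lt_one 3)] with p hp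
    have h := heisAnisoKlsIntegrand_planar_le hr.le (p := p) (hp 0)
    rw [hFdef, hAdef]
    simp only
    rw [← ENNReal.ofReal_mul (by positivity), ← ENNReal.ofReal_add (klsIntegrand_nonneg _ _)
      (mul_nonneg (by positivity) (anisoKlsIntegrand_nonneg _ _))]
    exact ENNReal.ofReal_le_ofReal h
  -- (3) integrate: the deleted coordinate gives a factor `2π`, then the certified 2D values
  have hF : ∫⁻ p in brillouin 3, F p ≤
      ENNReal.ofReal (2 * Real.pi) * ENNReal.ofReal (15 * Real.sqrt 2 * Real.pi ^ 2 / 16 + 4 * Real.pi) := by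
    rw [hbox, hFdef, setLIntegral_box_comp_succAbove (2 : Fin 3)
      (f := fun q : Fin 2 → ℝ => ENNReal.ofReal (klsIntegrand 2 q))
      (ENNReal.measurable_ofReal.comp (measurable_klsIntegrand 2))]
    exact mul_le_mul_right lintegral_klsIntegrand_two_le_sharp _
  have hA : ∫⁻ p in brillouin 3, A p ≤
      ENNReal.ofReal (2 * Real.pi) *
        ENNReal.ofReal (Real.sqrt 2 * Real.pi ^ 2 + 4 * Real.sqrt 2 * (3823 / 5040) * Real.pi) := by
    rw [hbox, hAdef, setLIntegral_box_comp_succAbove (2 : Fin 3)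
      (f := fun q : Fin 2 → ℝ => ENNReal.ofReal (anisoKlsIntegrand ![(1 : ℝ), 1] q))
      (ENNReal.measurable_ofReal.comp (measurable_anisoKlsIntegrand' _))]
    exact mul_le_mul_right lintegral_anisoKlsIntegrand_two_le _
  set X₁ : ℝ := 15 * Real.sqrt 2 * Real.pi ^ 2 / 16 + 4 * Real.pi with hX₁
  set X₂ : ℝ := Real.sqrt 2 * Real.pi ^ 2 + 4 * Real.sqrt 2 * (3823 / 5040) * Real.pi with hX₂
  set c : ℝ := r / (2 * Real.sqrt 2) with hc
  have hX₁0 : 0 ≤ X₁ := by positivity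
  have hX₂0 : 0 ≤ X₂ := by positivity
  have hc0 : 0 ≤ c := by positivity
  have hL : ∫⁻ p in brillouin 3, ENNReal.ofReal (heisAnisoKlsIntegrand K 0 μ p) ≤
      ENNReal.ofReal (2 * Real.pi * (X₁ + c * X₂)) := by
    calc ∫⁻ p in brillouin 3, ENNReal.ofReal (heisAnisoKlsIntegrand K 0 μ p)
        ≤ ∫⁻ p in brillouin 3, (F p + ENNReal.ofReal c * A p) := lintegral_mono_ae hae
      _ = (∫⁻ p in brillouin 3, F p) + ENNReal.ofReal c * ∫⁻ p in brillouin 3, A p := by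
          rw [lintegral_add_left hFm, lintegral_const_mul _ hAm]
      _ ≤ ENNReal.ofReal (2 * Real.pi) * ENNReal.ofReal X₁ +
            ENNReal.ofReal c * (ENNReal.ofReal (2 * Real.pi) * ENNReal.ofReal X₂) :=
          add_le_add hF (mul_le_mul_right hA _)
      _ = ENNReal.ofReal (2 * Real.pi * (X₁ + c * X₂)) := by
          rw [← ENNReal.ofReal_mul (by positivity), ← ENNReal.ofReal_mul (by positivity),
            ← ENNReal.ofReal_mul hc0, ← ENNReal.ofReal_add (by positivity) (by positivity)]
          congr 1
          ring
  have hreal : ∫ p in brillouin 3, heisAnisoKlsIntegrand K 0 μ p ≤ 2 * Real.pi * (X₁ + c * X₂) := by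
    rw [hint]
    exact ENNReal.toReal_le_of_le_ofReal (by positivity) hL
  -- (4) divide by `(2π)³`
  rw [heisAnisoKlsIntegral, div_le_iff₀ h2π3]
  refine hreal.trans (le_of_eq ?_)
  rw [hX₁, hX₂, hc]
  have hs2' : Real.sqrt 2 * Real.sqrt 2 = 2 := Real.mul_self_sqrt (by norm_num)
  field_simp
  nlinarith [hs2']

end Integral

/-! ### The real-arithmetic certificate -/

section Certificate

/-- **The certificate on the energy window.** For `S > 0`, `W ≥ 0` with `W√6 ≤ 4S` and
`s ≥ S²/3`: `S²/3 - SW/√6 ≤ s - (s/2)^{1/2} W` — AM–GM `√(s/2) ≤ s/(4a) + a/2` at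
`a = S/√6 = (S²/6)^{1/2}`, after which the lower bound is linear and nondecreasing in `s`.
[cite: KLS1988JSP, p. 1023] -/
theorem planar_certificate {S W s : ℝ} (hS : 0 < S) (hW : 0 ≤ W) (hW6 : W * Real.sqrt 6 ≤ 4 * S)
    (hs : S ^ 2 / 3 ≤ s) : S ^ 2 / 3 - S * W / Real.sqrt 6 ≤ s - Real.sqrt (s / 2) * W := by
  have h6 : 0 < Real.sqrt 6 := Real.sqrt_pos.2 (by norm_num)
  have h6sq : Real.sqrt 6 * Real.sqrt 6 = 6 := Real.mul_self_sqrt (by norm_num)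
  set a : ℝ := S / Real.sqrt 6 with ha
  have ha0 : 0 < a := by positivity
  have hs0 : 0 ≤ s := le_trans (by positivity) hs
  -- AM–GM: `√(s/2) ≤ (s/2)/(2a) + a/2`
  have hy := Real.sq_sqrt (by positivity : (0 : ℝ) ≤ s / 2)
  have hamgm : Real.sqrt (s / 2) ≤ (s / 2) / (2 * a) + a / 2 := by
    rw [div_add_div _ _ (by positivity) (by norm_num), le_div_iff₀ (by positivity)]
    nlinarith [sq_nonneg (Real.sqrt (s / 2) - a), Real.sqrt_nonneg (s / 2)]
  -- the coefficient of `s` is nonnegative: `W/(4a) ≤ 1`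
  have hcoef : W / (4 * a) ≤ 1 := by
    rw [div_le_one (by positivity), ha]
    have : W ≤ 4 * S / Real.sqrt 6 := by rw [le_div_iff₀ h6]; exact hW6
    calc W ≤ 4 * S / Real.sqrt 6 := this
      _ = 4 * (S / Real.sqrt 6) := by ring
  have hlin : s - Real.sqrt (s / 2) * W ≥ s * (1 - W / (4 * a)) - W * a / 2 := by
    have := mul_le_mul_of_nonneg_right hamgm hW
    have e : ((s / 2) / (2 * a) + a / 2) * W = s * (W / (4 * a)) + W * a / 2 := by
      field_simp
      ring
    nlinarith [this, e]
  have hmono : S ^ 2 / 3 * (1 - W / (4 * a)) - W * a / 2 ≤ s * (1 - W / (4 * a)) - W * a / 2 := by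
    have := mul_le_mul_of_nonneg_right hs (sub_nonneg.2 hcoef)
    linarith
  have e : S ^ 2 / 3 * (1 - W / (4 * a)) - W * a / 2 = S ^ 2 / 3 - S * W / Real.sqrt 6 := by
    rw [ha]
    field_simp
    nlinarith [h6sq]
  linarith [hlin, hmono, e]

/-- **The certificate with a slack `η ≥ 0` in the window** (the thermal window
`s ≥ S²/3 - η`): `S²/3 - SW/√6 - η ≤ s - (s/2)^{1/2} W` for `s ≥ 0`, `W√6 ≤ 4S` — the same AM–GM
linear minorant, whose slope `1 - W√6/(4S)` lies in `[0, 1]`. [cite: KLS1988JSP, p. 1023]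
[cite: DLS1978, Thm. 6.2] -/
theorem planar_certificate_slack {S W s η : ℝ} (hS : 0 < S) (hW : 0 ≤ W)
    (hW6 : W * Real.sqrt 6 ≤ 4 * S) (hη : 0 ≤ η) (hs0 : 0 ≤ s) (hs : S ^ 2 / 3 - η ≤ s) :
    S ^ 2 / 3 - S * W / Real.sqrt 6 - η ≤ s - Real.sqrt (s / 2) * W := by
  have h6 : 0 < Real.sqrt 6 := Real.sqrt_pos.2 (by norm_num)
  have h6sq : Real.sqrt 6 * Real.sqrt 6 = 6 := Real.mul_self_sqrt (by norm_num)
  set a : ℝ := S / Real.sqrt 6 with ha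
  have ha0 : 0 < a := by positivity
  have hy := Real.sq_sqrt (by positivity : (0 : ℝ) ≤ s / 2)
  have hamgm : Real.sqrt (s / 2) ≤ (s / 2) / (2 * a) + a / 2 := by
    rw [div_add_div _ _ (by positivity) (by norm_num), le_div_iff₀ (by positivity)]
    nlinarith [sq_nonneg (Real.sqrt (s / 2) - a), Real.sqrt_nonneg (s / 2)]
  have hcoef : W / (4 * a) ≤ 1 := by
    rw [div_le_one (by positivity), ha]
    have : W ≤ 4 * S / Real.sqrt 6 := by rw [le_div_iff₀ h6]; exact hW6
    calc W ≤ 4 * S / Real.sqrt 6 := this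
      _ = 4 * (S / Real.sqrt 6) := by ring
  have hcoef0 : 0 ≤ W / (4 * a) := by positivity
  have hlin : s - Real.sqrt (s / 2) * W ≥ s * (1 - W / (4 * a)) - W * a / 2 := by
    have := mul_le_mul_of_nonneg_right hamgm hW
    have e : ((s / 2) / (2 * a) + a / 2) * W = s * (W / (4 * a)) + W * a / 2 := by
      field_simp
      ring
    nlinarith [this, e]
  have hmono : (S ^ 2 / 3 - η) * (1 - W / (4 * a)) - W * a / 2 ≤
      s * (1 - W / (4 * a)) - W * a / 2 := by
    have := mul_le_mul_of_nonneg_right hs (sub_nonneg.2 hcoef)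
    linarith
  have hdrop : S ^ 2 / 3 * (1 - W / (4 * a)) - W * a / 2 - η ≤
      (S ^ 2 / 3 - η) * (1 - W / (4 * a)) - W * a / 2 := by
    nlinarith [mul_nonneg hη hcoef0]
  have e : S ^ 2 / 3 * (1 - W / (4 * a)) - W * a / 2 = S ^ 2 / 3 - S * W / Real.sqrt 6 := by
    rw [ha]
    field_simp
    nlinarith [h6sq]
  linarith [hlin, hmono, hdrop, e]

/-- The window in the direction-resolved certificate for `K = (1,1,r)`: from (N)
`ε₁ + ε₂ + rε₃ ≤ -(S²/3)(2+r) + η`, (X) `ε₁ ≤ ε₃` and (S) `ε₂ = ε₁`: `-ε₁ ≥ S²/3 - η/(2+r)`.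
[cite: KLS1988JSP, p. 1023] -/
theorem planar_window {r S η : ℝ} (hr : 0 < r) {ε : Fin 3 → ℝ} (hX : ∀ i, ε 0 ≤ ε i)
    (hSym : ε 1 = ε 0)
    (hN : ∑ i, (![(1 : ℝ), 1, r] : Fin 3 → ℝ) i * ε i ≤ -(S ^ 2 / 3) * ∑ i, (![(1 : ℝ), 1, r] : Fin 3 → ℝ) i + η) :
    S ^ 2 / 3 - η / (2 + r) ≤ -ε 0 := by
  rw [Fin.sum_univ_three, Fin.sum_univ_three] at hN
  simp only [Matrix.cons_val_zero, Matrix.cons_val_one, Matrix.cons_val, one_mul] at hN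
  rw [hSym] at hN
  have h2 := hX 2
  have h2r : 0 < 2 + r := by linarith
  have hmain : (2 + r) * ε 0 ≤ -(S ^ 2 / 3) * (2 + r) + η := by nlinarith
  have hq : (2 + r) * (η / (2 + r)) = η := by field_simp
  have key : (2 + r) * (S ^ 2 / 3 - η / (2 + r)) ≤ (2 + r) * (-ε 0) := by nlinarith [hmain, hq]
  exact le_of_mul_le_mul_left key h2r

end Certificate

/-! ### Néel order in the ground state -/

section Ground

variable {r : ℝ}

/-- Positivity and the maximal coupling of `K = (1, 1, r)`, `0 < r ≤ 1`. [cite: KLS1988JSP, eq. (5)] -/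
private theorem layered_pos_max (hr0 : 0 < r) (hr1 : r ≤ 1) :
    (∀ i, 0 < (![(1 : ℝ), 1, r] : Fin 3 → ℝ) i) ∧ (∀ i, (![(1 : ℝ), 1, r] : Fin 3 → ℝ) i ≤ ![(1 : ℝ), 1, r] 0) := by
  constructor
  · intro i; fin_cases i
    · show (0 : ℝ) < 1; norm_num
    · show (0 : ℝ) < 1; norm_num
    · show (0 : ℝ) < r; exact hr0
  · intro i; fin_cases i
    · exact le_rfl
    · show (1 : ℝ) ≤ 1; norm_num
    · show r ≤ 1; exact hr1

/-- **The ground-state floor from any strict upper bound of the integral** (`0 < r ≤ 1`,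
`S = n/2 > 0`, `W√6 ≤ 4S`, `𝓘^{(1,1,r)}_{0,(-½,-½,0)} < W`):
`liminf |Λ|⁻² Σ_{x,y}(-1)^{x+y}⟨𝐒_x·𝐒_y⟩_{GS} ≥ S² - (3/√6) S W`.
[cite: KLS1988JSP, eqs. (5)-(9), p. 1023] -/
theorem layeredHeis_planar_neelOrderParameter_ge_of_lt (hr0 : 0 < r) (hr1 : r ≤ 1) {n : ℕ}
    (hn : 1 ≤ n) {W : ℝ} (hW0 : 0 ≤ W) (hW6 : W * Real.sqrt 6 ≤ 4 * ((n : ℝ) / 2))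
    (hI : heisAnisoKlsIntegral ![(1 : ℝ), 1, r] 0 ![-(1 / 2 : ℝ), -(1 / 2), 0] < W) :
    ((n : ℝ) / 2) ^ 2 - 3 / Real.sqrt 6 * ((n : ℝ) / 2) * W ≤
      liminf (fun k : ℕ =>
        (∑ x : TorusSite 3 (2 * k + 2), ∑ y : TorusSite 3 (2 * k + 2),
          (-1 : ℝ) ^ (∑ i, (x i).val) * (-1) ^ (∑ i, (y i).val) *
            ∑ α : Fin 3, heisAnisoGroundCorr α (2 * k + 2) n ![(1 : ℝ), 1, r] x y) /
          ((2 * k + 2 : ℕ) : ℝ) ^ (2 * 3)) atTop := by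
  obtain ⟨hK, hmax⟩ := layered_pos_max hr0 hr1
  have hS : 0 < (n : ℝ) / 2 := by
    have : (1 : ℝ) ≤ n := by exact_mod_cast hn
    linarith
  have h := heisAniso_neelLRO_of_integral_dirCertificate (n := n) (le_refl 3) hK hmax
    (Finset.univ : Finset Unit) (fun _ => (0 : ℝ)) (fun _ => ![-(1 / 2 : ℝ), -(1 / 2), 0])
    (fun _ => W)
    (fun _ _ => by rw [planarMultiplier_sum]; norm_num) (fun _ _ => hI)
    (δ := ((n : ℝ) / 2) ^ 2 / 3 - (n : ℝ) / 2 * W / Real.sqrt 6)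
    (fun ε _ hX hSym hN _ => ⟨(), mem_univ _, by
      have hε1 : ε 1 = ε 0 := hSym 1 rfl
      have hwin := planar_window (S := (n : ℝ) / 2) (η := 0) hr0 hX hε1 (by simpa using hN)
      rw [zero_div, sub_zero] at hwin
      have hc := planar_certificate hS hW0 hW6 hwin
      rw [planarMultiplier_sum, Fin.sum_univ_three]
      simp only [Matrix.cons_val_zero, Matrix.cons_val_one, Matrix.cons_val, zero_mul,
        zero_add, sub_neg_eq_add, mul_one]
      rw [hε1]
      linarith [hc]⟩)
  have e3 : 3 * (((n : ℝ) / 2) ^ 2 / 3 - (n : ℝ) / 2 * W / Real.sqrt 6) =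
      ((n : ℝ) / 2) ^ 2 - 3 / Real.sqrt 6 * ((n : ℝ) / 2) * W := by ring
  rw [← e3]
  exact h

/-- **Néel order of the layered antiferromagnet, every spin `S ≥ 1`, every `0 < r ≤ 1`: the
explicit floor** `liminf |Λ|⁻² Σ_{x,y}(-1)^{x+y}⟨𝐒_x·𝐒_y⟩_{GS} ≥ S² - (3/√6)·S·W̄(r)`,
`W̄(r) = 15√2/64 + 1/π + r(1/8 + 3823/(10080π))`, along the even tori `(ℤ/2kℤ)³`.
[cite: KLS1988JSP, eqs. (5)-(9), p. 1020, p. 1023] [cite: KLS1988PRL, after eq. (8)] -/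
theorem layeredHeis_planar_neelOrderParameter_ge (hr0 : 0 < r) (hr1 : r ≤ 1) {n : ℕ} (hn : 2 ≤ n) :
    ((n : ℝ) / 2) ^ 2 - 3 / Real.sqrt 6 * ((n : ℝ) / 2) *
        (15 * Real.sqrt 2 / 64 + 1 / Real.pi + r * (1 / 8 + 3823 / (10080 * Real.pi))) ≤
      liminf (fun k : ℕ =>
        (∑ x : TorusSite 3 (2 * k + 2), ∑ y : TorusSite 3 (2 * k + 2),
          (-1 : ℝ) ^ (∑ i, (x i).val) * (-1) ^ (∑ i, (y i).val) *
            ∑ α : Fin 3, heisAnisoGroundCorr α (2 * k + 2) n ![(1 : ℝ), 1, r] x y) /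
          ((2 * k + 2 : ℕ) : ℝ) ^ (2 * 3)) atTop := by
  set Wb : ℝ := 15 * Real.sqrt 2 / 64 + 1 / Real.pi + r * (1 / 8 + 3823 / (10080 * Real.pi))
    with hWb
  have hS : (1 : ℝ) ≤ (n : ℝ) / 2 := by
    have : (2 : ℝ) ≤ n := by exact_mod_cast hn
    linarith
  have h6 : 0 < Real.sqrt 6 := Real.sqrt_pos.2 (by norm_num)
  have hs6 : Real.sqrt 6 < 2.45 := by
    rw [Real.sqrt_lt' (by norm_num)]; norm_num
  have hs2 : Real.sqrt 2 < 1.41422 := by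
    rw [Real.sqrt_lt' (by norm_num)]; norm_num
  have hπ : (1 : ℝ) / Real.pi < 1 / 3 := by
    rw [one_div_lt_one_div Real.pi_pos (by norm_num)]
    linarith [Real.pi_gt_three]
  have hπ' : (3823 : ℝ) / (10080 * Real.pi) < 3823 / 30240 := by
    apply div_lt_div_of_pos_left (by norm_num) (by norm_num)
    nlinarith [Real.pi_gt_three]
  have hWb0 : 0 ≤ Wb := planarBound_nonneg hr0.le
  -- `W̄(r) ≤ W̄(1) < 0.92`, so `(W̄ + η)√6 ≤ 4 ≤ 4S` for small `η`
  have hWb1 : Wb < 0.92 := by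
    rw [hWb]
    nlinarith [mul_le_mul_of_nonneg_right hr1
      (by positivity : (0 : ℝ) ≤ 1 / 8 + 3823 / (10080 * Real.pi))]
  refine le_of_forall_pos_le_add fun η hη => ?_
  set η' : ℝ := min η (1 / 10) / (3 / Real.sqrt 6 * ((n : ℝ) / 2) + 1) with hη'
  have hden : 0 < 3 / Real.sqrt 6 * ((n : ℝ) / 2) + 1 := by positivity
  have hη'0 : 0 < η' := by rw [hη']; positivity
  have hη'1 : η' ≤ 1 / 10 := by
    rw [hη', div_le_iff₀ hden]
    have : min η (1 / 10) ≤ 1 / 10 := min_le_right _ _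
    nlinarith [this, (by positivity : (0 : ℝ) ≤ 3 / Real.sqrt 6 * ((n : ℝ) / 2))]
  have hW6 : (Wb + η') * Real.sqrt 6 ≤ 4 * ((n : ℝ) / 2) := by nlinarith
  have h := layeredHeis_planar_neelOrderParameter_ge_of_lt hr0 hr1 (by omega) (W := Wb + η')
    (by positivity) hW6 (by linarith [heisAnisoKlsIntegral_planar_le hr0])
  have hcost : 3 / Real.sqrt 6 * ((n : ℝ) / 2) * η' ≤ η := by
    have h1 : 3 / Real.sqrt 6 * ((n : ℝ) / 2) * η' ≤ (3 / Real.sqrt 6 * ((n : ℝ) / 2) + 1) * η' :=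
      mul_le_mul_of_nonneg_right (by linarith) hη'0.le
    have h2 : (3 / Real.sqrt 6 * ((n : ℝ) / 2) + 1) * η' = min η (1 / 10) := by
      rw [hη']; field_simp
    linarith [min_le_left η (1 / 10)]
  have e : ((n : ℝ) / 2) ^ 2 - 3 / Real.sqrt 6 * ((n : ℝ) / 2) * (Wb + η') =
      ((n : ℝ) / 2) ^ 2 - 3 / Real.sqrt 6 * ((n : ℝ) / 2) * Wb - 3 / Real.sqrt 6 * ((n : ℝ) / 2) * η' := by
    ring
  linarith [h, e, hcost]

/-- Decimal form of the floor's slope: `(3/√6)·W̄(r) ≤ 0.7959 + 0.301 r` (`3/√6 = 1.2247…`,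
`W̄(r) = 0.64977… + 0.24573… r`). [cite: KLS1988PRL, after eq. (8)] -/
theorem planarBound_decimal {r : ℝ} (hr : 0 ≤ r) :
    3 / Real.sqrt 6 * (15 * Real.sqrt 2 / 64 + 1 / Real.pi + r * (1 / 8 + 3823 / (10080 * Real.pi))) ≤
      0.7959 + 0.301 * r := by
  have h6 : 0 < Real.sqrt 6 := Real.sqrt_pos.2 (by norm_num)
  have hs6 : 2.44948 < Real.sqrt 6 := by
    rw [Real.lt_sqrt (by norm_num)]; norm_num
  have hs2 : Real.sqrt 2 < 1.41422 := by
    rw [Real.sqrt_lt' (by norm_num)]; norm_num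
  have hπ3 : 3.14159 < Real.pi := by linarith [Real.pi_gt_d6]
  have hπ : (1 : ℝ) / Real.pi < 1 / 3.14159 := by
    rw [one_div_lt_one_div Real.pi_pos (by norm_num)]
    exact hπ3
  have hπ' : (3823 : ℝ) / (10080 * Real.pi) < 3823 / (10080 * 3.14159) :=
    div_lt_div_of_pos_left (by norm_num) (by norm_num) (by nlinarith)
  have hW : 15 * Real.sqrt 2 / 64 + 1 / Real.pi + r * (1 / 8 + 3823 / (10080 * Real.pi)) ≤
      0.649772 + 0.245731 * r := by
    nlinarith [mul_le_mul_of_nonneg_left hπ'.le hr]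
  rw [div_mul_eq_mul_div, div_le_iff₀ h6]
  nlinarith [mul_nonneg (sub_nonneg.2 hs6.le) (by positivity : (0 : ℝ) ≤ 0.649772 + 0.245731 * r),
    hW]

/-- **Néel long-range order of the layered spin-`S` antiferromagnet for every `S ≥ 3/2` and every
interlayer ratio `0 < r ≤ 1`, unconditionally**: the ground-state floor is
`≥ S² - (0.7959 + 0.301r)S ≥ S(S - 1.0969) > 0` for `n = 2S ≥ 3`
(improves `layeredHeis_neelLRO_largeSpin`, `S ≥ 11/2`). [cite: KLS1988JSP, §3, eq. (5), p. 1020]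
[cite: DLS1978, Thm. 6.2] -/
theorem layeredHeis_neelLRO_threeHalves (hr0 : 0 < r) (hr1 : r ≤ 1) {n : ℕ} (hn : 3 ≤ n) :
    0 < ((n : ℝ) / 2) * ((n : ℝ) / 2 - 1.0969) ∧
      ((n : ℝ) / 2) * ((n : ℝ) / 2 - 1.0969) ≤
        liminf (fun k : ℕ =>
          (∑ x : TorusSite 3 (2 * k + 2), ∑ y : TorusSite 3 (2 * k + 2),
            (-1 : ℝ) ^ (∑ i, (x i).val) * (-1) ^ (∑ i, (y i).val) *
              ∑ α : Fin 3, heisAnisoGroundCorr α (2 * k + 2) n ![(1 : ℝ), 1, r] x y) /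
            ((2 * k + 2 : ℕ) : ℝ) ^ (2 * 3)) atTop := by
  have hS : (1.5 : ℝ) ≤ (n : ℝ) / 2 := by
    have : (3 : ℝ) ≤ n := by exact_mod_cast hn
    linarith
  have h := layeredHeis_planar_neelOrderParameter_ge hr0 hr1 (by omega : 2 ≤ n)
  have hd := planarBound_decimal hr0.le
  refine ⟨mul_pos (by linarith) (by linarith), le_trans ?_ h⟩
  have hS0 : (0 : ℝ) ≤ (n : ℝ) / 2 := by linarith
  nlinarith [mul_le_mul_of_nonneg_left hd hS0, mul_le_mul_of_nonneg_left hr1 hS0]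

/-- **Néel long-range order of the layered antiferromagnet for every spin `S ≥ 1` and every
`0 < r ≤ 2/3`, unconditionally** — in particular for `S = 1`, the spin of [KLS1988JSP] p. 1020's
remark "`d = 2`, `S ≥ 1`", now with interlayer coupling: the floor is
`≥ S² - (0.7959 + 0.301r)S ≥ S(S - 0.9966) > 0`. [cite: KLS1988JSP, §3, eq. (5), p. 1020]
[cite: KLS1988PRL, after eq. (8)] -/
theorem layeredHeis_neelLRO_spinOne (hr0 : 0 < r) (hr23 : r ≤ 2 / 3) {n : ℕ} (hn : 2 ≤ n) :
    0 < ((n : ℝ) / 2) * ((n : ℝ) / 2 - 0.9966) ∧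
      ((n : ℝ) / 2) * ((n : ℝ) / 2 - 0.9966) ≤
        liminf (fun k : ℕ =>
          (∑ x : TorusSite 3 (2 * k + 2), ∑ y : TorusSite 3 (2 * k + 2),
            (-1 : ℝ) ^ (∑ i, (x i).val) * (-1) ^ (∑ i, (y i).val) *
              ∑ α : Fin 3, heisAnisoGroundCorr α (2 * k + 2) n ![(1 : ℝ), 1, r] x y) /
            ((2 * k + 2 : ℕ) : ℝ) ^ (2 * 3)) atTop := by
  have hS : (1 : ℝ) ≤ (n : ℝ) / 2 := by
    have : (2 : ℝ) ≤ n := by exact_mod_cast hn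
    linarith
  have hr1 : r ≤ 1 := by linarith
  have h := layeredHeis_planar_neelOrderParameter_ge hr0 hr1 hn
  have hd := planarBound_decimal hr0.le
  refine ⟨mul_pos (by linarith) (by linarith), le_trans ?_ h⟩
  have hS0 : (0 : ℝ) ≤ (n : ℝ) / 2 := by linarith
  nlinarith [mul_le_mul_of_nonneg_left hd hS0, mul_le_mul_of_nonneg_left hr23 hS0]

/-- **The spin-1 floor at moderate interlayer coupling**: for `n = 2` (`S = 1`) and `0 < r ≤ 1/2`,
`liminf |Λ|⁻² Σ_{x,y}(-1)^{x+y}⟨𝐒_x·𝐒_y⟩_{GS} ≥ 1/20`. [cite: KLS1988JSP, §3, eq. (5), p. 1020] -/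
theorem layeredHeis_neelOrderParameter_ge_spinOne_half (hr0 : 0 < r) (hr12 : r ≤ 1 / 2) :
    (1 : ℝ) / 20 ≤
      liminf (fun k : ℕ =>
        (∑ x : TorusSite 3 (2 * k + 2), ∑ y : TorusSite 3 (2 * k + 2),
          (-1 : ℝ) ^ (∑ i, (x i).val) * (-1) ^ (∑ i, (y i).val) *
            ∑ α : Fin 3, heisAnisoGroundCorr α (2 * k + 2) 2 ![(1 : ℝ), 1, r] x y) /
          ((2 * k + 2 : ℕ) : ℝ) ^ (2 * 3)) atTop := by
  have hr1 : r ≤ 1 := by linarith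
  have h := layeredHeis_planar_neelOrderParameter_ge hr0 hr1 (le_refl 2)
  have hd := planarBound_decimal hr0.le
  refine le_trans ?_ h
  norm_num at h hd ⊢
  nlinarith

end Ground

/-! ### Néel order at positive temperature -/

section Thermal

variable {r : ℝ}

/-- FILS's constant of the layered dispersion is Kennedy–Lieb–Shastry's `C(r)`.
[cite: KLS1988JSP, eq. (7)] [cite: FILS1978, eq. (4.7)] -/
private theorem infraredConstant_layered_eq (r : ℝ) :
    AnisotropicRotator.infraredConstant ![(1 : ℝ), 1, r] = AnisotropicRotator.klsConstant r := by
  rw [← layeredCoupling_one_eq, AnisotropicRotator.infraredConstant_layeredCoupling one_ne_zero,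
    div_one, div_one]

/-- **The thermal floor from strict upper bounds** (`0 < r ≤ 1`, `S = n/2 > 0`, `β > 0`,
`W√6 ≤ 4S`, `𝓘^{(1,1,r)}_{0,(-½,-½,0)} < W`, `C(r) < T̄`):
`liminf |Λ|⁻² Σ_{x,y}(-1)^{x+y}⟨𝐒_x·𝐒_y⟩_β ≥ S² - (3/√6)SW - log(n+1)/((2+r)β) - 3T̄/(2β)`
(thermal window (Nᵀ): `s ≥ S²/3 - log(n+1)/(3β(2+r))`; thermal term `T̄/(2β)` with the kernel
weight `max t 0 + Σ|μᵢ| = 1`). [cite: KLS1988JSP, p. 1020, p. 1023] [cite: DLS1978, Thms. 6.1, 6.2] -/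
theorem layeredHeis_planar_thermalNeelOrderParameter_ge_of_lt (hr0 : 0 < r) (hr1 : r ≤ 1) {n : ℕ}
    (hn : 1 ≤ n) {β : ℝ} (hβ : 0 < β) {W Tbar : ℝ} (hW0 : 0 ≤ W)
    (hW6 : W * Real.sqrt 6 ≤ 4 * ((n : ℝ) / 2))
    (hI : heisAnisoKlsIntegral ![(1 : ℝ), 1, r] 0 ![-(1 / 2 : ℝ), -(1 / 2), 0] < W)
    (hT : AnisotropicRotator.klsConstant r < Tbar) :
    ((n : ℝ) / 2) ^ 2 - 3 / Real.sqrt 6 * ((n : ℝ) / 2) * W -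
        Real.log (n + 1) / ((2 + r) * β) - 3 * Tbar / (2 * β) ≤
      liminf (fun k : ℕ =>
        (∑ x : TorusSite 3 (2 * k + 2), ∑ y : TorusSite 3 (2 * k + 2),
          (-1 : ℝ) ^ (∑ i, (x i).val) * (-1) ^ (∑ i, (y i).val) *
            ∑ α : Fin 3, gibbsSpinCorr β (heisAnisoTorus (2 * k + 2) n ![(1 : ℝ), 1, r]) α x y) /
          ((2 * k + 2 : ℕ) : ℝ) ^ (2 * 3)) atTop := by
  obtain ⟨hK, hmax⟩ := layered_pos_max hr0 hr1
  have hS : 0 < (n : ℝ) / 2 := by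
    have : (1 : ℝ) ≤ n := by exact_mod_cast hn
    linarith
  have h2r : 0 < 2 + r := by linarith
  have hlog : 0 ≤ Real.log (n + 1) := Real.log_nonneg (by
    have : (0 : ℝ) ≤ n := Nat.cast_nonneg n
    linarith)
  have h := heisAniso_thermal_neelLRO_of_integral_dirCertificate (n := n) (le_refl 3) hK hβ hmax
    (Finset.univ : Finset Unit) (fun _ => (0 : ℝ)) (fun _ => ![-(1 / 2 : ℝ), -(1 / 2), 0])
    (fun _ => W) (fun _ => Tbar)
    (fun _ _ => by rw [planarMultiplier_sum]; norm_num) (fun _ _ => hI)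
    (fun _ _ => by
      have e : (max (0 : ℝ) 0 + ∑ i : Fin 3, |(![-(1 / 2 : ℝ), -(1 / 2), 0] : Fin 3 → ℝ) i|) = 1 := by
        rw [max_self, Fin.sum_univ_three]
        show (0 : ℝ) + (|(-(1 / 2 : ℝ))| + |(-(1 / 2 : ℝ))| + |(0 : ℝ)|) = 1
        norm_num
      rw [e, one_mul, infraredConstant_layered_eq]
      exact hT)
    (δ := ((n : ℝ) / 2) ^ 2 / 3 - (n : ℝ) / 2 * W / Real.sqrt 6 -
      Real.log (n + 1) / (3 * β) / (2 + r) - Tbar / (2 * β))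
    (fun ε hneg hX hSym hN _ => ⟨(), mem_univ _, by
      have hε1 : ε 1 = ε 0 := hSym 1 rfl
      have hwin := planar_window (S := (n : ℝ) / 2) (η := Real.log (n + 1) / (3 * β)) hr0 hX hε1
        (by simpa using hN)
      have hs0 : 0 ≤ -ε 0 := by linarith [hneg 0]
      have hc := planar_certificate_slack hS hW0 hW6 (by positivity) hs0 hwin
      rw [planarMultiplier_sum, Fin.sum_univ_three]
      simp only [Matrix.cons_val_zero, Matrix.cons_val_one, Matrix.cons_val, zero_mul,
        zero_add, sub_neg_eq_add, mul_one]
      rw [hε1]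
      have e4 : 1 / (2 * β) * Tbar = Tbar / (2 * β) := by ring
      linarith [hc, e4]⟩)
  have e3 : 3 * (((n : ℝ) / 2) ^ 2 / 3 - (n : ℝ) / 2 * W / Real.sqrt 6 -
      Real.log (n + 1) / (3 * β) / (2 + r) - Tbar / (2 * β)) =
      ((n : ℝ) / 2) ^ 2 - 3 / Real.sqrt 6 * ((n : ℝ) / 2) * W -
        Real.log (n + 1) / ((2 + r) * β) - 3 * Tbar / (2 * β) := by
    field_simp
  rw [← e3]
  exact h

/-- **The thermal floor of the layered antiferromagnet, every spin `S ≥ 1`, every `0 < r ≤ 1`,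
every `β > 0`**: `liminf |Λ|⁻² Σ_{x,y}(-1)^{x+y}⟨𝐒_x·𝐒_y⟩_β ≥
S² - (3/√6)·S·W̄(r) - log(n+1)/((2+r)β) - 3C(r)/(2β)`, `C(r) = klsConstant r`
(`= (2π)⁻³∫d³p/E^{(1,1,r)}_p`), along the even tori `(ℤ/(2k+2)ℤ)³`.
[cite: KLS1988JSP, p. 1020, eqs. (5)-(9)] [cite: DLS1978, Thms. 6.1, 6.2] [cite: FILS1978, eq. (4.7)] -/
theorem layeredHeis_planar_thermalNeelOrderParameter_ge (hr0 : 0 < r) (hr1 : r ≤ 1) {n : ℕ}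
    (hn : 2 ≤ n) {β : ℝ} (hβ : 0 < β) :
    ((n : ℝ) / 2) ^ 2 - 3 / Real.sqrt 6 * ((n : ℝ) / 2) *
          (15 * Real.sqrt 2 / 64 + 1 / Real.pi + r * (1 / 8 + 3823 / (10080 * Real.pi))) -
        Real.log (n + 1) / ((2 + r) * β) - 3 * AnisotropicRotator.klsConstant r / (2 * β) ≤
      liminf (fun k : ℕ =>
        (∑ x : TorusSite 3 (2 * k + 2), ∑ y : TorusSite 3 (2 * k + 2),
          (-1 : ℝ) ^ (∑ i, (x i).val) * (-1) ^ (∑ i, (y i).val) *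
            ∑ α : Fin 3, gibbsSpinCorr β (heisAnisoTorus (2 * k + 2) n ![(1 : ℝ), 1, r]) α x y) /
          ((2 * k + 2 : ℕ) : ℝ) ^ (2 * 3)) atTop := by
  set Wb : ℝ := 15 * Real.sqrt 2 / 64 + 1 / Real.pi + r * (1 / 8 + 3823 / (10080 * Real.pi))
    with hWb
  set C : ℝ := AnisotropicRotator.klsConstant r with hC
  have hS : (1 : ℝ) ≤ (n : ℝ) / 2 := by
    have : (2 : ℝ) ≤ n := by exact_mod_cast hn
    linarith
  have h6 : 0 < Real.sqrt 6 := Real.sqrt_pos.2 (by norm_num)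
  have hs6 : Real.sqrt 6 < 2.45 := by
    rw [Real.sqrt_lt' (by norm_num)]; norm_num
  have hs2 : Real.sqrt 2 < 1.41422 := by
    rw [Real.sqrt_lt' (by norm_num)]; norm_num
  have hπ : (1 : ℝ) / Real.pi < 1 / 3 := by
    rw [one_div_lt_one_div Real.pi_pos (by norm_num)]
    linarith [Real.pi_gt_three]
  have hπ' : (3823 : ℝ) / (10080 * Real.pi) < 3823 / 30240 := by
    apply div_lt_div_of_pos_left (by norm_num) (by norm_num)
    nlinarith [Real.pi_gt_three]
  have hWb0 : 0 ≤ Wb := planarBound_nonneg hr0.le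
  have hWb1 : Wb < 0.92 := by
    rw [hWb]
    nlinarith [mul_le_mul_of_nonneg_right hr1
      (by positivity : (0 : ℝ) ≤ 1 / 8 + 3823 / (10080 * Real.pi))]
  refine le_of_forall_pos_le_add fun η hη => ?_
  -- split `η` between the integral slack and the thermal slack
  set η' : ℝ := min (η / 2) (1 / 10) / (3 / Real.sqrt 6 * ((n : ℝ) / 2) + 1) with hη'
  have hden : 0 < 3 / Real.sqrt 6 * ((n : ℝ) / 2) + 1 := by positivity
  have hη'0 : 0 < η' := by rw [hη']; positivity
  have hη'1 : η' ≤ 1 / 10 := by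
    rw [hη', div_le_iff₀ hden]
    have : min (η / 2) (1 / 10) ≤ 1 / 10 := min_le_right _ _
    nlinarith [this, (by positivity : (0 : ℝ) ≤ 3 / Real.sqrt 6 * ((n : ℝ) / 2))]
  have hW6 : (Wb + η') * Real.sqrt 6 ≤ 4 * ((n : ℝ) / 2) := by nlinarith
  have h := layeredHeis_planar_thermalNeelOrderParameter_ge_of_lt hr0 hr1 (by omega) hβ
    (W := Wb + η') (Tbar := C + β * η / 3) (by positivity) hW6
    (by linarith [heisAnisoKlsIntegral_planar_le hr0]) (by rw [hC]; linarith [mul_pos hβ hη])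
  have hcost : 3 / Real.sqrt 6 * ((n : ℝ) / 2) * η' ≤ η / 2 := by
    have h1 : 3 / Real.sqrt 6 * ((n : ℝ) / 2) * η' ≤ (3 / Real.sqrt 6 * ((n : ℝ) / 2) + 1) * η' :=
      mul_le_mul_of_nonneg_right (by linarith) hη'0.le
    have h2 : (3 / Real.sqrt 6 * ((n : ℝ) / 2) + 1) * η' = min (η / 2) (1 / 10) := by
      rw [hη']; field_simp
    linarith [min_le_left (η / 2) (1 / 10)]
  have e : ((n : ℝ) / 2) ^ 2 - 3 / Real.sqrt 6 * ((n : ℝ) / 2) * (Wb + η') -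
      Real.log (n + 1) / ((2 + r) * β) - 3 * (C + β * η / 3) / (2 * β) =
      ((n : ℝ) / 2) ^ 2 - 3 / Real.sqrt 6 * ((n : ℝ) / 2) * Wb -
        Real.log (n + 1) / ((2 + r) * β) - 3 * C / (2 * β) -
        3 / Real.sqrt 6 * ((n : ℝ) / 2) * η' - η / 2 := by
    field_simp
    ring
  linarith [h, e, hcost]

/-- **The thermal floor with the explicit interlayer logarithm**: for `0 < r ≤ 1`, `S = n/2 ≥ 1`,
`β > 0`: `liminf |Λ|⁻² Σ_{x,y}(-1)^{x+y}⟨𝐒_x·𝐒_y⟩_β ≥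
S² - (0.7959 + 0.301r)S - log(n+1)/((2+r)β) - 3(3 + log(1/r))/(2β)` (`klsConstant_le`).
[cite: KLS1988JSP, p. 1020, eqs. (5), (7)] [cite: DLS1978, Thm. 6.2] [cite: FILS1978, eq. (4.7)] -/
theorem layeredHeis_planar_thermalNeelOrderParameter_ge_explicit (hr0 : 0 < r) (hr1 : r ≤ 1)
    {n : ℕ} (hn : 2 ≤ n) {β : ℝ} (hβ : 0 < β) :
    ((n : ℝ) / 2) ^ 2 - (0.7959 + 0.301 * r) * ((n : ℝ) / 2) -
        Real.log (n + 1) / ((2 + r) * β) - 3 * (3 + Real.log (1 / r)) / (2 * β) ≤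
      liminf (fun k : ℕ =>
        (∑ x : TorusSite 3 (2 * k + 2), ∑ y : TorusSite 3 (2 * k + 2),
          (-1 : ℝ) ^ (∑ i, (x i).val) * (-1) ^ (∑ i, (y i).val) *
            ∑ α : Fin 3, gibbsSpinCorr β (heisAnisoTorus (2 * k + 2) n ![(1 : ℝ), 1, r]) α x y) /
          ((2 * k + 2 : ℕ) : ℝ) ^ (2 * 3)) atTop := by
  have h := layeredHeis_planar_thermalNeelOrderParameter_ge hr0 hr1 hn hβ
  have hd := planarBound_decimal hr0.le
  have hCle := AnisotropicRotator.klsConstant_le hr0 hr1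
  have hS0 : (0 : ℝ) ≤ (n : ℝ) / 2 := by positivity
  have hdiv : 3 * AnisotropicRotator.klsConstant r / (2 * β) ≤
      3 * (3 + Real.log (1 / r)) / (2 * β) :=
    div_le_div_of_nonneg_right (by linarith) (by positivity)
  nlinarith [mul_le_mul_of_nonneg_left hd hS0]

/-- **Néel long-range order of the layered spin-`S` antiferromagnet at positive temperature for
every `S ≥ 3/2` and every interlayer ratio `0 < r ≤ 1`**: for all inverse temperatures `β` with
`2β·S(S - 1.0969) > 2log(n+1)/(2+r) + 3(3 + log(1/r))`, the floor
`S(S - 1.0969) - log(n+1)/((2+r)β) - 3(3 + log(1/r))/(2β)` is positive and bounds the thermal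
staggered order parameter from below. In units of the in-plane exchange `J∥` (`J⊥ = rJ∥`): Néel
order for all `k_BT < 2J∥S(S - 1.0969)/(2log(2S+1)/(2+r) + 9 + 3log(J∥/J⊥))` — the
`1/log(J∥/J⊥)` Néel-temperature floor of quasi-two-dimensional antiferromagnets, now for the
physical spins `S = 3/2, 2, 5/2, …` (the tree's `layeredHeis_neelLRO_thermal_largeSpin` needs
`S ≥ 11/2`). [cite: KLS1988JSP, p. 1020, §3, eq. (5)] [cite: DLS1978, Thm. 6.2]
[cite: FILS1978, eq. (4.7), Thm. 4.7] -/
theorem layeredHeis_neelLRO_thermal_threeHalves (hr0 : 0 < r) (hr1 : r ≤ 1) {n : ℕ} (hn : 3 ≤ n)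
    {β : ℝ} (hβ : 0 < β)
    (hβT : 2 * Real.log (n + 1) / (2 + r) + 3 * (3 + Real.log (1 / r)) <
      2 * β * ((n : ℝ) / 2 * ((n : ℝ) / 2 - 1.0969))) :
    0 < (n : ℝ) / 2 * ((n : ℝ) / 2 - 1.0969) - Real.log (n + 1) / ((2 + r) * β) -
        3 * (3 + Real.log (1 / r)) / (2 * β) ∧
      (n : ℝ) / 2 * ((n : ℝ) / 2 - 1.0969) - Real.log (n + 1) / ((2 + r) * β) -
          3 * (3 + Real.log (1 / r)) / (2 * β) ≤
        liminf (fun k : ℕ =>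
          (∑ x : TorusSite 3 (2 * k + 2), ∑ y : TorusSite 3 (2 * k + 2),
            (-1 : ℝ) ^ (∑ i, (x i).val) * (-1) ^ (∑ i, (y i).val) *
              ∑ α : Fin 3, gibbsSpinCorr β (heisAnisoTorus (2 * k + 2) n ![(1 : ℝ), 1, r]) α x y) /
            ((2 * k + 2 : ℕ) : ℝ) ^ (2 * 3)) atTop := by
  have hS : (1.5 : ℝ) ≤ (n : ℝ) / 2 := by
    have : (3 : ℝ) ≤ n := by exact_mod_cast hn
    linarith
  have h := layeredHeis_planar_thermalNeelOrderParameter_ge_explicit hr0 hr1 (by omega : 2 ≤ n) hβ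
  have h2r : 0 < 2 + r := by linarith
  constructor
  · -- multiply the hypothesis by `1/(2β)`
    have e : (n : ℝ) / 2 * ((n : ℝ) / 2 - 1.0969) - Real.log (n + 1) / ((2 + r) * β) -
        3 * (3 + Real.log (1 / r)) / (2 * β) =
        (2 * β * ((n : ℝ) / 2 * ((n : ℝ) / 2 - 1.0969)) -
          (2 * Real.log (n + 1) / (2 + r) + 3 * (3 + Real.log (1 / r)))) / (2 * β) := by
      field_simp
      ring
    rw [e]
    exact div_pos (by linarith) (by positivity)
  · refine le_trans ?_ h
    have hS0 : (0 : ℝ) ≤ (n : ℝ) / 2 := by linarith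
    nlinarith [mul_le_mul_of_nonneg_left hr1 hS0]

/-- **Néel long-range order of the layered antiferromagnet at positive temperature for every spin
`S ≥ 1` and `0 < r ≤ 1/2`** — in particular the spin-1 layered antiferromagnet: for all `β` with
`2β·S(S - 0.9464) > 2log(n+1)/(2+r) + 3(3 + log(1/r))` the floor
`S(S - 0.9464) - log(n+1)/((2+r)β) - 3(3 + log(1/r))/(2β)` is positive and bounds the thermal
staggered order parameter from below. [cite: KLS1988JSP, p. 1020, §3, eq. (5)]
[cite: DLS1978, Thm. 6.2] [cite: FILS1978, eq. (4.7), Thm. 4.7] -/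
theorem layeredHeis_neelLRO_thermal_spinOne (hr0 : 0 < r) (hr12 : r ≤ 1 / 2) {n : ℕ} (hn : 2 ≤ n)
    {β : ℝ} (hβ : 0 < β)
    (hβT : 2 * Real.log (n + 1) / (2 + r) + 3 * (3 + Real.log (1 / r)) <
      2 * β * ((n : ℝ) / 2 * ((n : ℝ) / 2 - 0.9464))) :
    0 < (n : ℝ) / 2 * ((n : ℝ) / 2 - 0.9464) - Real.log (n + 1) / ((2 + r) * β) -
        3 * (3 + Real.log (1 / r)) / (2 * β) ∧
      (n : ℝ) / 2 * ((n : ℝ) / 2 - 0.9464) - Real.log (n + 1) / ((2 + r) * β) -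
          3 * (3 + Real.log (1 / r)) / (2 * β) ≤
        liminf (fun k : ℕ =>
          (∑ x : TorusSite 3 (2 * k + 2), ∑ y : TorusSite 3 (2 * k + 2),
            (-1 : ℝ) ^ (∑ i, (x i).val) * (-1) ^ (∑ i, (y i).val) *
              ∑ α : Fin 3, gibbsSpinCorr β (heisAnisoTorus (2 * k + 2) n ![(1 : ℝ), 1, r]) α x y) /
            ((2 * k + 2 : ℕ) : ℝ) ^ (2 * 3)) atTop := by
  have hS : (1 : ℝ) ≤ (n : ℝ) / 2 := by
    have : (2 : ℝ) ≤ n := by exact_mod_cast hn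
    linarith
  have hr1 : r ≤ 1 := by linarith
  have h := layeredHeis_planar_thermalNeelOrderParameter_ge_explicit hr0 hr1 hn hβ
  have h2r : 0 < 2 + r := by linarith
  constructor
  · have e : (n : ℝ) / 2 * ((n : ℝ) / 2 - 0.9464) - Real.log (n + 1) / ((2 + r) * β) -
        3 * (3 + Real.log (1 / r)) / (2 * β) =
        (2 * β * ((n : ℝ) / 2 * ((n : ℝ) / 2 - 0.9464)) -
          (2 * Real.log (n + 1) / (2 + r) + 3 * (3 + Real.log (1 / r)))) / (2 * β) := by
      field_simp
      ring
    rw [e]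
    exact div_pos (by linarith) (by positivity)
  · refine le_trans ?_ h
    have hS0 : (0 : ℝ) ≤ (n : ℝ) / 2 := by linarith
    nlinarith [mul_le_mul_of_nonneg_left hr12 hS0]

end Thermal

end Literature.MathematicalPhysics.QuantumLattice
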